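import Summits.KontsevichZagierPeriods.KontsevichZagierPeriods.Theorems.RootDecompRationalCubeDichotomySimpleBranchReImPoly

/-!
# Route RootDecompRationalCubeDichotomy — item 27842 `PiRationalisationSimpleBranch` PROVED, part 5/11 (`RootDecompRationalCubeDichotomySimpleBranchReImGreen`)

Theorems-split (≤ 400 lines each, sequential imports) of the decomp-kz lens-2 gen-4 file
`run/shared/lean/pub/decomp-kz/decomp-kz-lens-2/g4/PiRationalisationSimpleBranch27842.lean` (2963 lines; lens farm rc 0, writer re-check
rc 0 audit proof-of-item closed:true, critic g2 by-name probe std axioms, 2026-08-30T05:27:57Z/06:02:52Z). The rung: for simple-branch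
Nash data (`F(x,g) = 0`, `∂_z F(x,g) ≠ 0` on the closed cube) `[π]^K·[s] ∈ relations ⊔ ⟨rational closed-cube sector⟩` for all `K ≥ 1` —
root isolation on rational sub-boxes, the Green band move (planar Stokes inside the four moves), the half winding number ≡ 4[A] ≡ [π],
box rescaling, and `PiTimesSector` (item 26388, landed). The final part closes the ROUTE ITEM by name
(`piRationalisationSimpleBranch_proof`). Sector lemmas are REUSED from the landed rung-24903 file `…PiRationalisationSqrtMoves`.
[Kontsevich–Zagier 2001 §1.2; argument principle] Standard axioms, 0 sorry.
-/

noncomputable section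

set_option linter.dupNamespace false

namespace Summit.KontsevichZagierPeriods.RootDecompRationalCubeDichotomy.Rung27842.ReIm

open MvPolynomial QuadraticAlgebra
variable {n : ℕ}
open Literature.NumberTheory.Transcendental in

/-! ## Part 4: the Green band move for `h = N/D` — all analytic side conditions discharged

`KZ.of_sub_of_mem_relations_green` (Literature `KZGreenBandMove`) with `P = Im h`, `Q = Re h`, band integrand
`W = Re h'` (`h' = dNum/dDen`): the caller supplies only the three representations with the stated domains and
integrands and the non-vanishing of `D` on the closed rectangle band; semialgebraicity, fibre continuity, the two
line derivatives and closedness (Cauchy–Riemann, here literally `rfl`) come from Parts 1–3. -/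

open Literature.NumberTheory.Transcendental Literature.NumberTheory.Transcendental.KZ Set in
/-- **Green for `Im(h dz)`, `h = N/D`**: `[τ×[γ,δ], Re h(β+iv) − Re h(α+iv)] − [τ×[α,β], Im h(u+iδ) − Im h(u+iγ)] ∈ relations`. -/
theorem of_sub_of_mem_relations_green_rat {τ : Set (Fin n → ℝ)} {α β γ δ : (Fin n → ℝ) → ℝ}
    (N Dd : MvPolynomial (Fin (n + 1)) ℚ)
    (hα : IsSemialgebraicFunOn ℚ τ α) (hβ : IsSemialgebraicFunOn ℚ τ β)
    (hγ : IsSemialgebraicFunOn ℚ τ γ) (hδ : IsSemialgebraicFunOn ℚ τ δ)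
    (hαβ : ∀ x ∈ τ, α x ≤ β x) (hγδ : ∀ x ∈ τ, γ x ≤ δ x)
    (rW : IntegralRep (n + 2)) (bP bQ : IntegralRep (n + 1))
    (hrWd : rW.domain = KZlog.band (KZlog.band τ α β) (fun y => γ (Fin.init y)) (fun y => δ (Fin.init y)))
    (hD : ∀ w ∈ rW.domain, aeval (cplxPoint w) Dd ≠ 0)
    (hrWi : ∀ w ∈ rW.domain, rW.integrand w = ratRe (dNum N Dd) (dDen Dd) w)
    (hbPd : bP.domain = KZlog.band τ α β)
    (hbPi : ∀ y ∈ bP.domain,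
      bP.integrand y = ratIm N Dd (Fin.snoc y (δ (Fin.init y))) - ratIm N Dd (Fin.snoc y (γ (Fin.init y))))
    (hbQd : bQ.domain = KZlog.band τ γ δ)
    (hbQi : ∀ y ∈ bQ.domain, bQ.integrand y =
      ratRe N Dd (Fin.snoc (Fin.snoc (Fin.init y) (β (Fin.init y)) : Fin (n + 1) → ℝ) (y (Fin.last n))) -
        ratRe N Dd (Fin.snoc (Fin.snoc (Fin.init y) (α (Fin.init y)) : Fin (n + 1) → ℝ) (y (Fin.last n)))) :
    of bQ - of bP ∈ relations := by
  have memV : ∀ y ∈ KZlog.band τ α β, ∀ t ∈ Icc (γ (Fin.init y)) (δ (Fin.init y)),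
      (Fin.snoc y t : Fin (n + 2) → ℝ) ∈ rW.domain := by
    intro y hy t ht; rw [hrWd]; exact KZlog.snoc_mem_band.2 ⟨hy, ht⟩
  have memH : ∀ y ∈ KZlog.band τ γ δ, ∀ s ∈ Icc (α (Fin.init y)) (β (Fin.init y)),
      (Fin.snoc (Fin.snoc (Fin.init y) s : Fin (n + 1) → ℝ) (y (Fin.last n)) : Fin (n + 2) → ℝ) ∈ rW.domain := by
    intro y hy s hs; rw [hrWd]
    refine KZlog.snoc_mem_band.2 ⟨KZlog.snoc_mem_band.2 ⟨hy.1, hs⟩, ?_⟩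
    simpa using And.intro hy.2.1 hy.2.2
  exact of_sub_of_mem_relations_green (ratIm N Dd) (ratRe N Dd) hα hβ hγ hδ hαβ hγδ rW rW bP bQ hrWd rfl
    (isSemialgebraicFunOn_ratIm N Dd rW.isSemialgebraic_domain hD)
    (isSemialgebraicFunOn_ratRe N Dd rW.isSemialgebraic_domain hD)
    (fun y hy => continuousOn_ratIm_vertical N Dd y fun s hs => hD _ (memV y hy s hs))
    (fun y hy t ht => (hasDerivAt_ratIm_vertical N Dd y t
      (hD _ (memV y hy t (Ioo_subset_Icc_self ht)))).congr_deriv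
        (hrWi _ (memV y hy t (Ioo_subset_Icc_self ht))).symm)
    (fun y hy => continuousOn_ratRe_horizontal N Dd (Fin.init y) (y (Fin.last n))
      fun s hs => hD _ (memH y hy s hs))
    (fun y hy t ht => (hasDerivAt_ratRe_horizontal N Dd (Fin.init y) (y (Fin.last n)) t
      (hD _ (memH y hy t (Ioo_subset_Icc_self ht)))).congr_deriv
        (hrWi _ (memH y hy t (Ioo_subset_Icc_self ht))).symm)
    (fun _ _ => rfl) hbPd hbPi hbQd hbQi

end Summit.KontsevichZagierPeriods.RootDecompRationalCubeDichotomy.Rung27842.ReIm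

/-! ## Part 5 (gen 4, final pass): assembly kit for `GreenReduction`

5a. `Im h` vanishes on the real axis (pointwise, junk-value-safe);
5b. the RESIDUE FORM (double divided difference): `h − g/(w−g) = Nr(x,g,w)/Dr(x,g,w)` with `Nr, Dr ∈ ℚ[x,y,w]`,
    i.e. `Res_{w=g(x)} w F_w/F dw = g(x)` as a polynomial identity (the argument principle's local input);
5c. the complex / real-imaginary forms of that identity on the edges of the inner square;
5d. the Green band move for `Re/Im (N/D)(x, g(x), u+iv)` (polynomial data composed with a semialgebraic continuous
    graph parameter) — the move that kills the remainder `r = h − pole` on the inner square. -/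

namespace Summit.KontsevichZagierPeriods.RootDecompRationalCubeDichotomy.Rung27842.ReIm

open MvPolynomial

variable {n : ℕ}

/-! ### 5a. Real-axis vanishing -/

/-- Auxiliary step `cplxPoint_snoc_zero`. [bookkeeping] -/
theorem cplxPoint_snoc_zero (y : Fin (n + 1) → ℝ) :
    cplxPoint (Fin.snoc y 0 : Fin (n + 2) → ℝ) = fun i => ((y i : ℝ) : ℂ) := by
  rw [cplxPoint_snoc]
  funext i
  refine Fin.lastCases ?_ (fun j => ?_) i
  · simp
  · simp

/-- `Im (N/D)(x, u + 0·i) = 0` for every real point (including the zeros of `D`: junk value `0`). -/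
theorem ratIm_snoc_zero (N D : MvPolynomial (Fin (n + 1)) ℚ) (y : Fin (n + 1) → ℝ) :
    ratIm N D (Fin.snoc y 0) = 0 := by
  simp only [ratIm, cplxPoint_snoc_zero, RootIso.aeval_ofReal_comp, ← Complex.ofReal_div, Complex.ofReal_im]

/-! ### 5b. The residue form (pure algebra) -/

/-- Index embedding `(x, w) ↦ (x, ·, w)` skipping the `y` slot of `Fin (n+2)`. -/
def skipY (n : ℕ) : Fin (n + 1) → Fin (n + 2) :=
  fun j => Fin.lastCases (Fin.last (n + 1)) (fun i : Fin n => Fin.castSucc (Fin.castSucc i)) j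

/-- Auxiliary step `snoc_snoc_comp_skipY`. [bookkeeping] -/
theorem snoc_snoc_comp_skipY {A : Type} (x : Fin n → A) (y w : A) :
    (Fin.snoc (Fin.snoc x y : Fin (n + 1) → A) w : Fin (n + 2) → A) ∘ skipY n = (Fin.snoc x w : Fin (n + 1) → A) := by
  funext j
  refine Fin.lastCases ?_ (fun i => ?_) j
  · simp [skipY]
  · simp [skipY]

/-- Index map `(x, y, y', w) ↦ (x, y, y, w)` collapsing the `y'` slot of `Fin (n+3)` onto `y`. -/
def collapseY (n : ℕ) : Fin (n + 3) → Fin (n + 2) :=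
  fun j => Fin.lastCases (Fin.last (n + 1))
    (fun j' : Fin (n + 2) => Fin.lastCases (Fin.castSucc (Fin.last n)) (fun i : Fin (n + 1) => Fin.castSucc i) j') j

/-- Auxiliary step `snoc_snoc_comp_collapseY`. [bookkeeping] -/
theorem snoc_snoc_comp_collapseY {A : Type} (x : Fin n → A) (y w : A) :
    (Fin.snoc (Fin.snoc x y : Fin (n + 1) → A) w : Fin (n + 2) → A) ∘ collapseY n =
      (Fin.snoc (Fin.snoc (Fin.snoc x y : Fin (n + 1) → A) y : Fin (n + 2) → A) w : Fin (n + 3) → A) := by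
  funext j
  refine Fin.lastCases ?_ (fun j' => ?_) j
  · simp [collapseY]
  · refine Fin.lastCases ?_ (fun i => ?_) j'
    · simp [collapseY]
    · simp [collapseY]

/-- **Residue form of `w·F_w/F` at a simple root (pure algebra).** There are `Nr, Dr ∈ ℚ[x,y,w]` with
`F(x,w) − F(x,y) = (w−y)·Dr(x,y,w)`, `Dr(x,y,y) = F_w(x,y)` and `w·F_w(x,w) − y·Dr(x,y,w) = (w−y)·Nr(x,y,w)`;
hence at a root `y` of `F(x,·)`: `w F_w(x,w)/F(x,w) − y/(w−y) = Nr(x,y,w)/Dr(x,y,w)` — the residue of `h dw` at the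
root is the root. [folklore: divided differences] -/
theorem exists_residueForm (F : MvPolynomial (Fin (n + 1)) ℚ) :
    ∃ Nr Dr : MvPolynomial (Fin (n + 2)) ℚ,
      (∀ {A : Type} [CommRing A] [Algebra ℚ A] (x : Fin n → A) (y w : A),
        aeval (Fin.snoc x w : Fin (n + 1) → A) F - aeval (Fin.snoc x y : Fin (n + 1) → A) F =
          (w - y) * aeval (Fin.snoc (Fin.snoc x y : Fin (n + 1) → A) w : Fin (n + 2) → A) Dr) ∧
      (∀ {A : Type} [CommRing A] [Algebra ℚ A] (x : Fin n → A) (y : A),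
        aeval (Fin.snoc (Fin.snoc x y : Fin (n + 1) → A) y : Fin (n + 2) → A) Dr =
          aeval (Fin.snoc x y : Fin (n + 1) → A) (pderiv (Fin.last n) F)) ∧
      (∀ {A : Type} [CommRing A] [Algebra ℚ A] (x : Fin n → A) (y w : A),
        w * aeval (Fin.snoc x w : Fin (n + 1) → A) (pderiv (Fin.last n) F) -
            y * aeval (Fin.snoc (Fin.snoc x y : Fin (n + 1) → A) w : Fin (n + 2) → A) Dr =
          (w - y) * aeval (Fin.snoc (Fin.snoc x y : Fin (n + 1) → A) w : Fin (n + 2) → A) Nr) := by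
  obtain ⟨Dr, h1, h2⟩ := RootIso.exists_divDiff F
  set G : MvPolynomial (Fin (n + 2)) ℚ :=
    X (Fin.last (n + 1)) * rename (skipY n) (pderiv (Fin.last n) F) - X (Fin.castSucc (Fin.last n)) * Dr with hG
  obtain ⟨K', hK1, -⟩ := RootIso.exists_divDiff (n := n + 1) G
  refine ⟨rename (collapseY n) K', Dr, h1, h2, fun x y w => ?_⟩
  have hGw : aeval (Fin.snoc (Fin.snoc x y : Fin (n + 1) → _) w : Fin (n + 2) → _) G =
      w * aeval (Fin.snoc x w : Fin (n + 1) → _) (pderiv (Fin.last n) F) -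
        y * aeval (Fin.snoc (Fin.snoc x y : Fin (n + 1) → _) w : Fin (n + 2) → _) Dr := by
    simp only [hG, map_sub, map_mul, aeval_X, Fin.snoc_last, Fin.snoc_castSucc, aeval_rename,
      snoc_snoc_comp_skipY]
  have hGy : aeval (Fin.snoc (Fin.snoc x y : Fin (n + 1) → _) y : Fin (n + 2) → _) G = 0 := by
    simp only [hG, map_sub, map_mul, aeval_X, Fin.snoc_last, Fin.snoc_castSucc, aeval_rename,
      snoc_snoc_comp_skipY, h2, sub_self]
  have := hK1 (Fin.snoc x y) y w
  rw [hGy, sub_zero, hGw] at this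
  rw [this, aeval_rename, snoc_snoc_comp_collapseY]

/-! ### 5c. The residue identity over `ℂ` and its real / imaginary parts -/

/-- `cplxPoint (x, s, v) = cpt x (s + iv)`. -/
theorem cplxPoint_snoc_snoc_eq_cpt (x : Fin n → ℝ) (s v : ℝ) :
    cplxPoint (Fin.snoc (Fin.snoc x s : Fin (n + 1) → ℝ) v) = RootIso.cpt x ((s : ℂ) + (v : ℂ) * Complex.I) := by
  rw [cplxPoint_snoc_snoc]; rfl

/-- **The residue identity.** At a real root `y` of `F(x,·)` and a point `z ≠ y` with `F(x,z) ≠ 0`: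
`Dr(x,y,z) ≠ 0` and `z F_w(x,z)/F(x,z) − y/(z−y) = Nr(x,y,z)/Dr(x,y,z)`. -/
theorem residue_identity {F : MvPolynomial (Fin (n + 1)) ℚ} {Nr Dr : MvPolynomial (Fin (n + 2)) ℚ}
    (h1 : ∀ {A : Type} [CommRing A] [Algebra ℚ A] (x : Fin n → A) (y w : A),
        aeval (Fin.snoc x w : Fin (n + 1) → A) F - aeval (Fin.snoc x y : Fin (n + 1) → A) F =
          (w - y) * aeval (Fin.snoc (Fin.snoc x y : Fin (n + 1) → A) w : Fin (n + 2) → A) Dr)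
    (h3 : ∀ {A : Type} [CommRing A] [Algebra ℚ A] (x : Fin n → A) (y w : A),
        w * aeval (Fin.snoc x w : Fin (n + 1) → A) (pderiv (Fin.last n) F) -
            y * aeval (Fin.snoc (Fin.snoc x y : Fin (n + 1) → A) w : Fin (n + 2) → A) Dr =
          (w - y) * aeval (Fin.snoc (Fin.snoc x y : Fin (n + 1) → A) w : Fin (n + 2) → A) Nr)
    (x : Fin n → ℝ) (y : ℝ) (z : ℂ)
    (hF0 : aeval (Fin.snoc x y : Fin (n + 1) → ℝ) F = 0) (hz : z ≠ (y : ℂ))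
    (hFz : aeval (RootIso.cpt x z) F ≠ 0) :
    aeval (Fin.snoc (RootIso.cpt x (y : ℂ)) z : Fin (n + 2) → ℂ) Dr ≠ 0 ∧
      z * aeval (RootIso.cpt x z) (pderiv (Fin.last n) F) / aeval (RootIso.cpt x z) F - (y : ℂ) / (z - y) =
        aeval (Fin.snoc (RootIso.cpt x (y : ℂ)) z : Fin (n + 2) → ℂ) Nr /
          aeval (Fin.snoc (RootIso.cpt x (y : ℂ)) z : Fin (n + 2) → ℂ) Dr := by
  have hF0' : aeval (RootIso.cpt x (y : ℂ)) F = 0 := by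
    rw [RootIso.cpt_ofReal, RootIso.aeval_ofReal_comp, hF0, Complex.ofReal_zero]
  have e1 : aeval (RootIso.cpt x z) F =
      (z - y) * aeval (Fin.snoc (RootIso.cpt x (y : ℂ)) z : Fin (n + 2) → ℂ) Dr := by
    have := h1 (fun i => ((x i : ℝ) : ℂ)) (y : ℂ) z
    simp only [RootIso.cpt] at hF0' ⊢
    rw [hF0', sub_zero] at this
    exact this
  have e3 := h3 (fun i => ((x i : ℝ) : ℂ)) (y : ℂ) z
  simp only [RootIso.cpt] at e1 e3 hFz ⊢
  have hzy : z - (y : ℂ) ≠ 0 := sub_ne_zero.2 hz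
  have hD : aeval (Fin.snoc (Fin.snoc (fun i => ((x i : ℝ) : ℂ)) (y : ℂ) : Fin (n + 1) → ℂ) z : Fin (n + 2) → ℂ) Dr ≠ 0 := by
    intro h; apply hFz; rw [e1, h, mul_zero]
  refine ⟨hD, ?_⟩
  rw [e1, div_sub_div _ _ (mul_ne_zero hzy hD) hzy, div_eq_div_iff (mul_ne_zero (mul_ne_zero hzy hD) hzy) hD]
  linear_combination (z - (y:ℂ)) * aeval (Fin.snoc (Fin.snoc (fun i => ((x i : ℝ) : ℂ)) (y : ℂ) : Fin (n + 1) → ℂ) z : Fin (n + 2) → ℂ) Dr * e3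

/-- Real part of the pole term `y/(s + iv − y)`. -/
theorem pole_re (y s v : ℝ) (h : (s - y) ^ 2 + v ^ 2 ≠ 0) :
    ((y : ℂ) / (((s : ℂ) + (v : ℂ) * Complex.I) - y)).re = y * (s - y) / ((s - y) ^ 2 + v ^ 2) := by
  have hz : ((s : ℂ) + (v : ℂ) * Complex.I) - y = ⟨s - y, v⟩ := by
    apply Complex.ext <;> simp
  rw [hz, Complex.div_re, Complex.normSq_mk]
  simp only [Complex.ofReal_re, Complex.ofReal_im]
  field_simp
  ring

/-- Imaginary part of the pole term `y/(s + iv − y)`. -/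
theorem pole_im (y s v : ℝ) (h : (s - y) ^ 2 + v ^ 2 ≠ 0) :
    ((y : ℂ) / (((s : ℂ) + (v : ℂ) * Complex.I) - y)).im = -(y * v) / ((s - y) ^ 2 + v ^ 2) := by
  have hz : ((s : ℂ) + (v : ℂ) * Complex.I) - y = ⟨s - y, v⟩ := by
    apply Complex.ext <;> simp
  rw [hz, Complex.div_im, Complex.normSq_mk]
  simp only [Complex.ofReal_re, Complex.ofReal_im]
  field_simp
  ring

/-- The numerator polynomial of `h = w·F_w/F`. -/
def hNum (F : MvPolynomial (Fin (n + 1)) ℚ) : MvPolynomial (Fin (n + 1)) ℚ := X (Fin.last n) * pderiv (Fin.last n) F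

/-- **`Re h = Re(pole) + Re r` and `Im h = Im(pole) + Im r` on the punctured isolation region** (real form of the
residue identity; `r = Nr/Dr` at the graph point `(x, g x, s, v)`). -/
theorem ratRe_ratIm_hNum_eq {F : MvPolynomial (Fin (n + 1)) ℚ} {Nr Dr : MvPolynomial (Fin (n + 2)) ℚ}
    (h1 : ∀ {A : Type} [CommRing A] [Algebra ℚ A] (x : Fin n → A) (y w : A),
        aeval (Fin.snoc x w : Fin (n + 1) → A) F - aeval (Fin.snoc x y : Fin (n + 1) → A) F =
          (w - y) * aeval (Fin.snoc (Fin.snoc x y : Fin (n + 1) → A) w : Fin (n + 2) → A) Dr)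
    (h3 : ∀ {A : Type} [CommRing A] [Algebra ℚ A] (x : Fin n → A) (y w : A),
        w * aeval (Fin.snoc x w : Fin (n + 1) → A) (pderiv (Fin.last n) F) -
            y * aeval (Fin.snoc (Fin.snoc x y : Fin (n + 1) → A) w : Fin (n + 2) → A) Dr =
          (w - y) * aeval (Fin.snoc (Fin.snoc x y : Fin (n + 1) → A) w : Fin (n + 2) → A) Nr)
    (x : Fin n → ℝ) (y s v : ℝ)
    (hF0 : aeval (Fin.snoc x y : Fin (n + 1) → ℝ) F = 0) (hsv : ¬ (s = y ∧ v = 0))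
    (hFz : aeval (cplxPoint (Fin.snoc (Fin.snoc x s : Fin (n + 1) → ℝ) v)) F ≠ 0) :
    aeval (cplxPoint (Fin.snoc (Fin.snoc (Fin.snoc x y : Fin (n + 1) → ℝ) s : Fin (n + 2) → ℝ) v)) Dr ≠ 0 ∧
    ratRe (hNum F) F (Fin.snoc (Fin.snoc x s : Fin (n + 1) → ℝ) v) =
        y * (s - y) / ((s - y) ^ 2 + v ^ 2) +
          ratRe Nr Dr (Fin.snoc (Fin.snoc (Fin.snoc x y : Fin (n + 1) → ℝ) s : Fin (n + 2) → ℝ) v) ∧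
      ratIm (hNum F) F (Fin.snoc (Fin.snoc x s : Fin (n + 1) → ℝ) v) =
        -(y * v) / ((s - y) ^ 2 + v ^ 2) +
          ratIm Nr Dr (Fin.snoc (Fin.snoc (Fin.snoc x y : Fin (n + 1) → ℝ) s : Fin (n + 2) → ℝ) v) := by
  set z : ℂ := (s : ℂ) + (v : ℂ) * Complex.I with hzdef
  have hz : z ≠ (y : ℂ) := by
    intro h
    apply hsv
    have hre := congrArg Complex.re h
    have him := congrArg Complex.im h
    simp [hzdef] at hre him
    exact ⟨hre, him⟩
  have hFz' : aeval (RootIso.cpt x z) F ≠ 0 := by rwa [cplxPoint_snoc_snoc_eq_cpt] at hFz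
  obtain ⟨hD, hid⟩ := residue_identity h1 h3 x y z hF0 hz hFz'
  have hpt : cplxPoint (Fin.snoc (Fin.snoc (Fin.snoc x y : Fin (n + 1) → ℝ) s : Fin (n + 2) → ℝ) v) =
      (Fin.snoc (RootIso.cpt x (y : ℂ)) z : Fin (n + 2) → ℂ) := by
    rw [cplxPoint_snoc_snoc_eq_cpt, RootIso.cpt_ofReal]; rfl
  have hsq : (s - y) ^ 2 + v ^ 2 ≠ 0 := by
    intro h0
    apply hsv
    have h1' : (s - y) ^ 2 = 0 := by nlinarith [sq_nonneg (s - y), sq_nonneg v]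
    have h2' : v ^ 2 = 0 := by nlinarith [sq_nonneg (s - y), sq_nonneg v]
    exact ⟨by simpa [sub_eq_zero] using pow_eq_zero_iff (n := 2) (by norm_num) |>.1 h1',
      pow_eq_zero_iff (n := 2) (by norm_num) |>.1 h2'⟩
  have hh : aeval (cplxPoint (Fin.snoc (Fin.snoc x s : Fin (n + 1) → ℝ) v)) (hNum F) /
      aeval (cplxPoint (Fin.snoc (Fin.snoc x s : Fin (n + 1) → ℝ) v)) F =
      (y : ℂ) / (z - y) + aeval (Fin.snoc (RootIso.cpt x (y : ℂ)) z : Fin (n + 2) → ℂ) Nr /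
          aeval (Fin.snoc (RootIso.cpt x (y : ℂ)) z : Fin (n + 2) → ℂ) Dr := by
    rw [← hid, cplxPoint_snoc_snoc_eq_cpt]
    simp only [hNum, map_mul, aeval_X, RootIso.cpt, Fin.snoc_last]
    ring
  refine ⟨by rw [hpt]; exact hD, ?_, ?_⟩
  · simp only [ratRe]
    rw [hh, hpt, Complex.add_re, pole_re y s v hsq]
  · simp only [ratIm]
    rw [hh, hpt, Complex.add_im, pole_im y s v hsq]

end Summit.KontsevichZagierPeriods.RootDecompRationalCubeDichotomy.Rung27842.ReIm
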